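import Summits.MatrixMultiplication.MatrixMultiplication.Theses.EisensteinValCertificates
import Summits.MatrixMultiplication.MatrixMultiplication.Theses.FourierTwoFamiliesModP
import Literature.Computability.AlgebraicComplexity.SimultaneousDoubleProduct
import Literature.Computability.AlgebraicComplexity.PrattTrapezoidValSDPP
import Summits.MatrixMultiplication.MatrixMultiplication.Theorems.EisensteinValCertificatesHomocyclicSTPPDesignsStubDesignLift

/-!
# Crux `HomocyclicSTPPDesigns` (stmt-MatrixMultiplication-10647) — `Lines/birth.lean`, the BC3 birth skeleton

Route `EisensteinValCertificates`, crux #0 (ex-target, auto-crux) `HomocyclicSTPPDesigns` = X′: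
for every `ε > 0` some prime power `q`, some `ℓ` and some STPP family `(A_i,B_i,C_i)_{i<N}` in
`(ℤ/q)^ℓ` (tree `IsSTPP`) with `q^ℓ < Σ_i (|A_i||B_i||C_i|)^{(2+ε)/3}` — the DECIDING side of the
route (`closes : X′ → MatrixMultiplication` is proved in the route file); the route itself bets X′ is
FALSE and staffs the kill ladder (PrimeValSaving → PrimeValConjecture → NoHomocyclicSTPP = ¬X′).

THE LINE (the only positive mechanism in print for abelian STPP designs in hosts of UNBOUNDED
exponent — every bounded-exponent construction is dead on arrival by BCCGNSU 2017 Thm B, tree theorem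
`BlasiakChurchCohnGrochowNaslundSawinUmans2017_B_holds`): the Cohn–Kleinberg–Szegedy–Umans
TWO-FAMILIES LIFT at prime moduli.  CKSU 2005 §4/§6.2 (arXiv:math/0511460 pp. 7, 10–11; Pratt 2024
arXiv:2309.03878, proof of Thm 4.7 p. 10): `n` pairs `(A_i,B_i)` in an abelian group `H` with the
simultaneous double product property (tree `IsSDPP`, CKSU Def 4.1) and a corner-free index set
`S ⊂ Δ_n` of size `n^{2-o(1)}` (Behrend, Mathlib `Behrend.roth_lower_bound`) give the STPP family
`Â_v = A_{v₁} × {0} × B_{v₃}`, `B̂_v = B_{v₁} × A_{v₂} × {0}`, `Ĉ_v = {0} × B_{v₂} × A_{v₃}` (`v ∈ S`)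
in `H³`, with `|Â_v||B̂_v||Ĉ_v| = ∏_t |A_{v_t}||B_{v_t}|`.  With `H = ℤ/p` and the CKSU Conj 4.7
parameters (`p ≤ n^{2+δ}`, `|A_i||B_i| ≥ n^{2-δ}`) the packing sum at exponent `(2+ε)/3` is
`≥ n^{2-δ} · n^{(2-δ)(2+ε)} > n^{3(2+δ)} ≥ p³ = |(ℤ/p)³|` as soon as `6δ + δε < 2ε` (take
`δ = ε/(8+ε)`) and `n ≥ 2` — an X′-witness in the homocyclic host `Fin 3 → ZMod p`, `q = p` prime.

* `stub_primeTwoFamilies` (OPEN, conjecture-grade — the line's whole bet) — CKSU Conj 4.7 with prime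
  cyclic hosts, BY NAME the existing item `FourierTwoFamiliesModP.PrimeTwoFamilies`
  (stmt-MatrixMultiplication-14308, a live crux with its own lines `Cruxes/PrimeTwoFamilies/Lines/*`,
  Disproof.lean and STRATEGY-CENSUS; equivalent to GroupTheoreticSTPP.CPackingConstruction = CKSU
  Conj 4.7 over all finite abelian groups by the landed `CyclicReduction`).  HONEST DISCLOSURE for the
  BC3 audit: this stub DECIDES THE SUMMIT by a landed theorem — `FourierTwoFamiliesModP.closes :
  PrimeTwoFamilies → MatrixMultiplication` (route file, sorry-free) — and the BC3 probe
  `stub_primeTwoFamilies → MatrixMultiplication` by `first | exact? | simpa | aesop` SUCCEEDS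
  (checked 2026-08-17: `exact?` closes it, rc 0), i.e. this skeleton FAILS BC3 on that one probe; the
  other three probes (`stub_primeTwoFamilies → HomocyclicSTPPDesigns`, `stub_designLift → crux`,
  `stub_designLift → MatrixMultiplication`) fail as required (rc 1, aesop exhaustive search failed).
  The stub does NOT give the crux X′ cheaply (no landed `PrimeTwoFamilies → HomocyclicSTPPDesigns`;
  that passage is exactly `stub_designLift` + the arithmetic of `homocyclicSTPPDesigns_of_lift`).
  Why it is nevertheless the right first stub: X′ is WEAKER than PrimeTwoFamilies (designs need not be SDPP lifts) but no construction
  of unbounded-exponent abelian designs other than the SDPP lift exists or is conjectured in print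
  (BCCGNSU 2017 §1 p. 3; Pratt 2024 §4), and the SDPP design space of `ℤ/p` carries a developed
  finite calculus (Cruxes/PrimeTwoFamilies/STRATEGY-CENSUS.md: scale function `c(γ)`, ladders,
  certified censuses) that the raw STPP design space of `(ℤ/q)^ℓ` lacks — the transfer exposes THAT.
* `stub_designLift` (provable now, size M) — the CKSU lift as a DESIGN-PRODUCING lemma with homocyclic
  output: for every `δ > 0` and all large `n`, every SDPP family of `n` pairs in any abelian `H` yields
  an STPP family `(A'_v,B'_v,C'_v)_{v<N}` in `Fin 3 → H` with `N ≥ n^{2-δ}` triples, each of size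
  product `(|A_i||B_i|)(|A_j||B_j|)(|A_k||B_k|)` for some indices `i j k`.  Proof sketch (tree lemmas):
  `exists_cornerFree_indexMaps_card_ge` (η := δ/2, then `n^{2-δ} ≤ n^{2-η}/64` for `n ≥ 64^{2/δ}`),
  `addSimultaneousTPP_of_sdpp`, transport along the additive equivalence `H × H × H ≃+ (Fin 3 → H)`
  (an injective additive map preserves `AddSimultaneousTPP`; `Finset.card_image_of_injective`),
  reindexing `Fin N ≃ ι₀` (`AddSimultaneousTPP.comp`), `isSTPP_iff_addSimultaneousTPP`,
  `card_mul_card_mul_card_sdpp`.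

`homocyclicSTPPDesigns_of_lift` composes the two stub SIGNATURES into the crux statement with a real
proof (the exponent count above, `δ := ε/(8+ε)`; conclusion = the crux text verbatim, and an `example`
retypes it as `PrimeTwoFamilies → <lift> → HomocyclicSTPPDesigns`); `HomocyclicSTPPDesigns_of :
HomocyclicSTPPDesigns` is the one theorem concluding the crux BY NAME, from the two stubs
(sorry-dependence only through the two `stub_*`).

Disproof used: none exists for this crux (`ledger crux ls stmt-MatrixMultiplication-10647`: no
workfiles at registration; no `Theorems/HomocyclicSTPPDesigns/Negative/`).  Negatives index /
landed refutations touching the line: `Theorems/PrimeTwoFamilies/Negative/Shapes.lean` bounds SDPP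
families using boundedly many SHAPES (translates) — a constraint on witnesses of `stub_primeTwoFamilies`,
not a refutation of it; BCCGNSU Thm B (tree) forces `p → ∞` along the witnesses, consistent with the
stub (`p ≤ n^{2+δ}`, `n → ∞`, and `|A_i||B_i| ≤ p` by `IsSDPP.card_mul_card_le`).
-/

set_option linter.dupNamespace false

namespace Summit.MatrixMultiplication.MatrixMultiplication.Cruxes.HomocyclicSTPPDesigns.Birth

open Summit.MatrixMultiplication.MatrixMultiplication.Theses.EisensteinValCertificates
open Summit.MatrixMultiplication.MatrixMultiplication.Theses.FourierTwoFamiliesModP (PrimeTwoFamilies)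
open Literature.Computability.AlgebraicComplexity
open scoped BigOperators

/-- STUB 1 — CKSU Conjecture 4.7 with prime cyclic hosts (OPEN, conjecture-grade; the line's bet),
BY NAME the existing item `FourierTwoFamiliesModP.PrimeTwoFamilies` (stmt-MatrixMultiplication-14308):
for every `δ > 0` and arbitrarily large `n`, a prime `p ≤ n^{2+δ}` and `n` SDPP pairs `(A_i, B_i)` in
`ℤ/p` with `|A_i||B_i| ≥ n^{2-δ}`.  Summit-deciding by the landed
`FourierTwoFamiliesModP.closes` (disclosed in the module docstring). -/
theorem stub_primeTwoFamilies : PrimeTwoFamilies := by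
  sorry

/-- STUB 2 (CLOSED — landed as `DesignLift.stub_designLift`, p146750) — the CKSU two-families lift as a
design-producing lemma with homocyclic output (proved from `exists_cornerFree_indexMaps_card_ge`, `addSimultaneousTPP_of_sdpp`,
`AddSimultaneousTPP.comp`, `isSTPP_iff_addSimultaneousTPP`, `card_mul_card_mul_card_sdpp` and the
additive equivalence `H × H × H ≃+ (Fin 3 → H)`; size M): for every `δ > 0` there is `n₁` such that
for all `n ≥ n₁`, every SDPP family of `n` pairs in an abelian group `H` yields an STPP family of
`N ≥ n^{2-δ}` triples in `Fin 3 → H` whose size products are products of three of the `|A_i||B_i|`.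
[CohnKleinbergSzegedyUmans2005 §4 Def 4.1 and §6.2 "Triangle-free sets" (arXiv:math/0511460 text:
Definition 20, the construction before Theorem 22, Lemma 35); Pratt2024 = arXiv:2309.03878, proof of
Thm 4.7 (p. 10); tree: `Literature/Computability/AlgebraicComplexity/PrattTrapezoidValSDPP.lean`] -/
theorem stub_designLift :
    ∀ δ : ℝ, 0 < δ → ∃ n₁ : ℕ, ∀ n ≥ n₁, ∀ (H : Type) [AddCommGroup H]
      (A B : Fin n → Finset H), IsSDPP A B →
      ∃ (N : ℕ) (A' B' C' : Fin N → Finset (Fin 3 → H)),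
        IsSTPP A' B' C' ∧ (n : ℝ) ^ (2 - δ) ≤ N ∧
        ∀ v : Fin N, ∃ i j k : Fin n,
          (A' v).card * (B' v).card * (C' v).card =
            ((A i).card * (B i).card) * ((A j).card * (B j).card) * ((A k).card * (B k).card) :=
  -- LANDED (p146750): Theorems/EisensteinValCertificatesHomocyclicSTPPDesignsStubDesignLift.lean
  Summit.MatrixMultiplication.MatrixMultiplication.Theorems.HomocyclicSTPPDesigns.DesignLift.stub_designLift

/-- COMPOSITION (real proof, no `sorry` of its own): the two stub SIGNATURES give the crux statement —
stated here with the crux text unfolded VERBATIM (so that exactly one theorem of this file,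
`HomocyclicSTPPDesigns_of` below, concludes the crux decl BY NAME, as the tree's skeleton audit wants;
the `example` right after certifies the by-name typing `PrimeTwoFamilies → <lift> → HomocyclicSTPPDesigns`).
Given `ε > 0` put `δ := ε/(8+ε)` (so `0 < δ < 1` and `3(2+δ) < (2-δ) + (2-δ)(2+ε)`); take the SDPP
family of `stub_primeTwoFamilies` at this `δ` with `n ≥ max(n₁, 2)`, lift it by `stub_designLift`
(its SDPP clauses are literally `IsSDPP`), and count: `p³ ≤ n^{3(2+δ)} < n^{(2-δ)+(2-δ)(2+ε)} ≤
N · n^{(2-δ)(2+ε)} ≤ Σ_v (|A'_v||B'_v||C'_v|)^{(2+ε)/3}`; the witness is `q := p`, `ℓ := 3`. -/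
theorem homocyclicSTPPDesigns_of_lift
    (hTF : PrimeTwoFamilies)
    (hLift : ∀ δ : ℝ, 0 < δ → ∃ n₁ : ℕ, ∀ n ≥ n₁, ∀ (H : Type) [AddCommGroup H]
      (A B : Fin n → Finset H), IsSDPP A B →
      ∃ (N : ℕ) (A' B' C' : Fin N → Finset (Fin 3 → H)),
        IsSTPP A' B' C' ∧ (n : ℝ) ^ (2 - δ) ≤ N ∧
        ∀ v : Fin N, ∃ i j k : Fin n,
          (A' v).card * (B' v).card * (C' v).card =
            ((A i).card * (B i).card) * ((A j).card * (B j).card) * ((A k).card * (B k).card)) :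
    ∀ ε : ℝ, 0 < ε → ∃ q ℓ : ℕ, IsPrimePow q ∧ ∃ (N : ℕ) (A B C : Fin N → Finset (Fin ℓ → ZMod q)),
      IsSTPP A B C ∧
        (q : ℝ) ^ ℓ < ∑ i, (((A i).card * (B i).card * (C i).card : ℕ) : ℝ) ^ ((2 + ε) / 3) := by
  intro ε hε
  -- the slack `δ`
  obtain ⟨δ, hδ, hδ1, hkey⟩ :
      ∃ δ : ℝ, 0 < δ ∧ δ < 1 ∧ 3 * (2 + δ) < (2 - δ) + (2 - δ) * (2 + ε) := by
    refine ⟨ε / (8 + ε), by positivity, ?_, ?_⟩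
    · rw [div_lt_one (by positivity)]
      linarith
    · have h8 : (8 : ℝ) + ε ≠ 0 := by positivity
      have h1 : ε / (8 + ε) * (8 + ε) = ε := div_mul_cancel₀ ε h8
      have h0 : 0 < ε / (8 + ε) := by positivity
      nlinarith [h1, h0, hε]
  -- the lift threshold and the SDPP family
  obtain ⟨n₁, hn₁⟩ := hLift δ hδ
  obtain ⟨n, hn, p, hp, A, B, hW, hX, hpn, hAB⟩ := hTF δ hδ (n₁ + 2)
  obtain ⟨N, A', B', C', hS, hN, hprod⟩ := hn₁ n (by omega) (ZMod p) A B ⟨hW, hX⟩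
  refine ⟨p, 3, hp.isPrimePow, N, A', B', C', hS, ?_⟩
  -- arithmetic
  have hn1 : (1 : ℝ) < n := by exact_mod_cast (show 1 < n by omega)
  have hnpos : (0 : ℝ) < n := by linarith
  have hYpos : (0 : ℝ) < (n : ℝ) ^ (2 - δ) := Real.rpow_pos_of_pos hnpos _
  -- the host: `p³ ≤ n^{3(2+δ)}`
  have hhost : (p : ℝ) ^ 3 ≤ (n : ℝ) ^ (3 * (2 + δ)) := by
    calc (p : ℝ) ^ 3 ≤ ((n : ℝ) ^ (2 + δ)) ^ 3 := by gcongr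
      _ = (n : ℝ) ^ (3 * (2 + δ)) := by
          rw [← Real.rpow_natCast ((n : ℝ) ^ (2 + δ)) 3, ← Real.rpow_mul hnpos.le]
          congr 1
          push_cast
          ring
  -- each term of the packing sum is at least `n^{(2-δ)(2+ε)}`
  have hterm : ∀ v : Fin N, (n : ℝ) ^ ((2 - δ) * (2 + ε)) ≤
      (((A' v).card * (B' v).card * (C' v).card : ℕ) : ℝ) ^ ((2 + ε) / 3) := by
    intro v
    obtain ⟨i, j, k, hijk⟩ := hprod v
    have hcast : (((A' v).card * (B' v).card * (C' v).card : ℕ) : ℝ) =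
        (((A i).card * (B i).card : ℕ) : ℝ) * (((A j).card * (B j).card : ℕ) : ℝ) *
          (((A k).card * (B k).card : ℕ) : ℝ) := by
      rw [hijk]
      push_cast
      ring
    have h1 := hAB i
    have h2 := hAB j
    have h3 := hAB k
    have h12 : (n : ℝ) ^ (2 - δ) * (n : ℝ) ^ (2 - δ) ≤
        (((A i).card * (B i).card : ℕ) : ℝ) * (((A j).card * (B j).card : ℕ) : ℝ) :=
      mul_le_mul h1 h2 hYpos.le (hYpos.le.trans h1)
    have hYYY : (n : ℝ) ^ (2 - δ) * (n : ℝ) ^ (2 - δ) * (n : ℝ) ^ (2 - δ) ≤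
        (((A' v).card * (B' v).card * (C' v).card : ℕ) : ℝ) := by
      rw [hcast]
      calc (n : ℝ) ^ (2 - δ) * (n : ℝ) ^ (2 - δ) * (n : ℝ) ^ (2 - δ)
          ≤ (((A i).card * (B i).card : ℕ) : ℝ) * (((A j).card * (B j).card : ℕ) : ℝ) *
              (n : ℝ) ^ (2 - δ) := mul_le_mul_of_nonneg_right h12 hYpos.le
        _ ≤ (((A i).card * (B i).card : ℕ) : ℝ) * (((A j).card * (B j).card : ℕ) : ℝ) *
              (((A k).card * (B k).card : ℕ) : ℝ) :=
            mul_le_mul_of_nonneg_left h3 ((mul_pos hYpos hYpos).le.trans h12)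
    have hY3 : ((n : ℝ) ^ (2 - δ) * (n : ℝ) ^ (2 - δ) * (n : ℝ) ^ (2 - δ)) ^ ((2 + ε) / 3) =
        (n : ℝ) ^ ((2 - δ) * (2 + ε)) := by
      rw [← Real.rpow_add hnpos, ← Real.rpow_add hnpos, ← Real.rpow_mul hnpos.le]
      congr 1
      ring
    rw [← hY3]
    exact Real.rpow_le_rpow (mul_pos (mul_pos hYpos hYpos) hYpos).le hYYY (by positivity)
  -- summing over the `N` triples
  have hsum : (N : ℝ) * (n : ℝ) ^ ((2 - δ) * (2 + ε)) ≤
      ∑ v : Fin N, (((A' v).card * (B' v).card * (C' v).card : ℕ) : ℝ) ^ ((2 + ε) / 3) := by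
    have h1 := Finset.sum_le_sum fun v (_ : v ∈ (Finset.univ : Finset (Fin N))) => hterm v
    rw [Finset.sum_const, Finset.card_univ, Fintype.card_fin, nsmul_eq_mul] at h1
    exact h1
  have hlow : (n : ℝ) ^ ((2 - δ) + (2 - δ) * (2 + ε)) ≤ (N : ℝ) * (n : ℝ) ^ ((2 - δ) * (2 + ε)) := by
    rw [Real.rpow_add hnpos]
    exact mul_le_mul_of_nonneg_right hN (Real.rpow_nonneg hnpos.le _)
  have hlt : (n : ℝ) ^ (3 * (2 + δ)) < (n : ℝ) ^ ((2 - δ) + (2 - δ) * (2 + ε)) :=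
    Real.rpow_lt_rpow_of_exponent_lt hn1 hkey
  calc (p : ℝ) ^ 3 ≤ (n : ℝ) ^ (3 * (2 + δ)) := hhost
    _ < (n : ℝ) ^ ((2 - δ) + (2 - δ) * (2 + ε)) := hlt
    _ ≤ (N : ℝ) * (n : ℝ) ^ ((2 - δ) * (2 + ε)) := hlow
    _ ≤ ∑ v : Fin N, (((A' v).card * (B' v).card * (C' v).card : ℕ) : ℝ) ^ ((2 + ε) / 3) := hsum

/-- By-name typing of the composition: the two stub signatures imply the crux decl (the crux `def`
unfolds to the conclusion of `homocyclicSTPPDesigns_of_lift` by `rfl`). -/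
example : PrimeTwoFamilies →
    (∀ δ : ℝ, 0 < δ → ∃ n₁ : ℕ, ∀ n ≥ n₁, ∀ (H : Type) [AddCommGroup H]
      (A B : Fin n → Finset H), IsSDPP A B →
      ∃ (N : ℕ) (A' B' C' : Fin N → Finset (Fin 3 → H)),
        IsSTPP A' B' C' ∧ (n : ℝ) ^ (2 - δ) ≤ N ∧
        ∀ v : Fin N, ∃ i j k : Fin n,
          (A' v).card * (B' v).card * (C' v).card =
            ((A i).card * (B i).card) * ((A j).card * (B j).card) * ((A k).card * (B k).card)) →
    HomocyclicSTPPDesigns :=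
  homocyclicSTPPDesigns_of_lift

/-- THE SKELETON THEOREM: the crux BY NAME from the two registered stubs (sorry-dependence only
through `stub_primeTwoFamilies` and `stub_designLift`; the composition `homocyclicSTPPDesigns_of_lift`
is sorry-free, axioms {propext, Classical.choice, Quot.sound}). -/
theorem HomocyclicSTPPDesigns_of : HomocyclicSTPPDesigns :=
  homocyclicSTPPDesigns_of_lift stub_primeTwoFamilies stub_designLift

end Summit.MatrixMultiplication.MatrixMultiplication.Cruxes.HomocyclicSTPPDesigns.Birth
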